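import Literature.NumberTheory.Multiplicative.CorradiKatai1969.Defs
import HarnessLib

/-!
# Corrádi–Kátai (1969), Conjecture 1: Lemma 2.1 and the thin-flip comparison

Source: K. A. Corrádi and I. Kátai, *Some problems concerning the convolutions of number-theoretical functions*,
Arch. Math. (Basel) **20** (1969) 24–29, doi:10.1007/BF01898986 [CorradiKatai1969], p. 25: the class `M` of
multiplicative `±1`-valued functions, `h_f(n) = Σ_{ν=1}^{n−1} f(ν)f(n−ν)` ((1.1)), relation (1.2) `h_f(n) = o(n)`,
`C(f) = Σ_{p : f(p) = −1} 1/p`, "character-type" (periodic on the residues coprime to some `K ≥ 1`), and their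
**Conjecture 1** (p. 25, verbatim modulo notation): "If f ∈ M and f is not a 'character-type', then for the fulfilment
of (1.2) the condition C(f) = ∞ is a necessary and sufficient one."  CATEGORY: an explicitly labelled conjecture,
REFUTED (the sufficiency half fails) by an explicit family of counterexamples.  The analytic input is Dirichlet's
theorem in the form `Σ_{p ≡ a (k)} 1/p = ∞` for `(a,k) = 1` (H. L. Montgomery, R. C. Vaughan, *Multiplicative Number
Theory I*, CUP 2007 [MontgomeryVaughan2007], Cor. 4.12(c), p. 103), which is the tree theorem
`Literature.NumberTheory.LFunctions.not_summable_one_div_on_primes_in_residueClass` — so everything here is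
unconditional (standard axioms).

Counterexample (2001 H21 programme, Theorem 1.1 = `theoremCE`): for any infinite set `R` of odd primes with
`Σ_{p∈R} 1/p ≤ 1/8` (finitary form: every finite subsum `≤ 1/8`; one is constructed, `exists_admissible_R`: the least
primes above `16^{j+1}`), the completely multiplicative `f = fCE R` with `f(2) = 1`, `f(p) = χ₄(p)` (`p ∉ R`),
`f(p) = −χ₄(p)` (`p ∈ R`) has `C(f) = ∞`, is not of character-type, and `h_f(2^s) ≤ −2^{s−1} + 3` for all `s ≥ 2`
(unperturbed: `h_{f₀}(2^s) = −2^s + 3`, Lemma 2.1 `hCK_f0_two_pow`; thin-flip comparison `hCK_fCE_two_pow_le`), so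
`h_f(n) ≠ o(n)`: sufficiency fails, **`ckStatementOne_false : ¬ CKStatementOne`**.

This module (2001 file, second part): Lemma 2.1 `hCK_f0_two_pow : h_{f₀}(2^s) = −2^s + 3` (`s ≥ 2`; the pairs
`ν, 2^s − ν` have `f₀(ν)f₀(2^s−ν) = −1` except at the three "diagonal" places), and the thin-flip comparison:
`badSet`, `hCK_fCE_sub_le : |h_f(N) − h_{f₀}(N)| ≤ 2·#{ν < N : some p ∈ R divides ν(N−ν)}`, `card_badSet_le` (a union
bound using the finitary hypothesis `Σ_{p∈F⊆R} 1/p ≤ 1/8`), hence `hCK_fCE_two_pow_le : h_f(2^s) ≤ −2^{s−1} + 3`.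

Modules: `Literature.NumberTheory.Multiplicative.CorradiKatai1969.Defs` (objects, the interface Prop and its proof, the construction `f₀`, `Ω_R`, `fCE` and basic
facts), `.ThinFlip` (Lemma 2.1 and the thin-flip comparison: `h_f(2^s) ≤ −2^{s−1} + 3`), `.Density` (`C(f) = ∞`, not
character-type, `h_f ≠ o(n)`, `theoremCE`), `.Refutation` (an admissible `R` exists, `CKStatementOne`,
`ckStatementOne_false`, smoke tests).

Provenance: refutations bundle `papers/_cross/refutations` (H21 seat pub-refute-2, 2026-08-18), package modules
`Refutations.Vendor2001.CorradiKatai` (the 2001 H21 programme's kernel-checked file, archive route `summits/gb/free/y10`,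
refereed note Theorem 1.1, "upheld 2026-08-07"; namespace `CorradiKatai` there) and `Refutations.CorradiKatai1969`
(the unconditional wrapper), moved into the tree under the Lean-in-tree rule (human 2026-08-18).  Renamed:
`CKConjectureOne ↦ CKStatementOne`, `ckConjectureOne_false (hdir) ↦ ckStatementOne_false_of`, and the unconditional
`corradiKataiConjecture1_false ↦ ckStatementOne_false`; the 2001 interface Prop `DirichletReciprocalDivergence` is kept
and PROVED (`dirichletReciprocalDivergence`, module `Defs`).
-/

open Finset

namespace Literature.NumberTheory.Multiplicative.CorradiKatai1969

noncomputable section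
open scoped Classical

/-! ### Lemma 2.1: the values of `f₀` at powers of two -/

/-- Paper Lemma 2.1 (lem:f0), pointwise form: for `s ≥ 2` and `1 ≤ ν < 2^s` with
`ν ≠ 2^{s−1}`, one has `f₀(ν) f₀(2^s − ν) = −1`. [folklore] -/
theorem f0_mul_f0_eq_neg_one {s ν : ℕ} (hs : 2 ≤ s) (hν1 : 1 ≤ ν) (hνlt : ν < 2 ^ s)
    (hne : ν ≠ 2 ^ (s - 1)) : f0 ν * f0 (2 ^ s - ν) = -1 := by
  have hν0 : ν ≠ 0 := by omega
  obtain ⟨l, μ, hμodd, hfac⟩ : ∃ l μ, μ % 2 = 1 ∧ 2 ^ l * μ = ν :=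
    ⟨ν.factorization 2, ordCompl[2] ν, ordCompl2_odd hν0,
      Nat.ordProj_mul_ordCompl_eq_self ν 2⟩
  have hμ1 : 1 ≤ μ := by omega
  -- `l < s`
  have hls : l < s := by
    by_contra hcon
    have hcon' : s ≤ l := Nat.le_of_not_lt hcon
    have h1 : (2 : ℕ) ^ s ≤ 2 ^ l := Nat.pow_le_pow_right (by norm_num) hcon'
    have h2 : (2 : ℕ) ^ l ≤ 2 ^ l * μ := Nat.le_mul_of_pos_right _ (by omega)
    omega
  -- `l ≠ s − 1` (else `ν = 2^{s−1}`)
  have hlne : l ≠ s - 1 := by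
    intro hl1
    have h3 : (2 : ℕ) ^ s = 2 ^ l * 2 := by
      rw [← pow_succ]
      congr 1
      omega
    have hmul : 2 ^ l * μ < 2 ^ l * 2 := by rw [hfac, ← h3]; exact hνlt
    have hμlt : μ < 2 := Nat.lt_of_mul_lt_mul_left hmul
    have hμeq : μ = 1 := by omega
    exact hne (by rw [← hfac, hμeq, mul_one, hl1])
  have hlss : l + 2 ≤ s := by omega
  -- decompose `2^s − ν = 2^l (2^{s−l} − μ)`
  have hpow : (2 : ℕ) ^ s = 2 ^ l * 2 ^ (s - l) := by
    rw [← pow_add]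
    congr 1
    omega
  have hμlt2 : μ < 2 ^ (s - l) := by
    have hmul : 2 ^ l * μ < 2 ^ l * 2 ^ (s - l) := by rw [hfac, ← hpow]; exact hνlt
    exact Nat.lt_of_mul_lt_mul_left hmul
  have hsum : 2 ^ l * (2 ^ (s - l) - μ) + 2 ^ l * μ = 2 ^ s := by
    rw [← Nat.mul_add, Nat.sub_add_cancel hμlt2.le, ← pow_add]
    congr 1
    omega
  have key : 2 ^ s - ν = 2 ^ l * (2 ^ (s - l) - μ) := by omega
  -- the cofactor `2^{s−l} − μ` is odd
  have h4dvd : (4 : ℕ) ∣ 2 ^ (s - l) := by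
    have h44 : (4 : ℕ) = 2 ^ 2 := by norm_num
    rw [h44]
    exact pow_dvd_pow 2 (by omega)
  obtain ⟨c, hc⟩ := h4dvd
  have hcodd : (2 ^ (s - l) - μ) % 2 = 1 := by omega
  -- rewrite both `f₀` values through the decomposition
  have hf1 : f0 ν = ZMod.χ₄ ((μ : ℕ) : ZMod 4) := by
    rw [← hfac]
    exact f0_two_pow_mul hμodd
  have hf2 : f0 (2 ^ s - ν) = ZMod.χ₄ (((2 ^ (s - l) - μ : ℕ) : ℕ) : ZMod 4) := by
    rw [key]
    exact f0_two_pow_mul hcodd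
  rw [hf1, hf2]
  -- `χ₄(μ) χ₄(2^{s−l} − μ) = −1` since `2^{s−l} − μ ≡ −μ (mod 4)`
  rcases (by omega : μ % 4 = 1 ∨ μ % 4 = 3) with h1 | h3
  · have hm3 : (2 ^ (s - l) - μ) % 4 = 3 := by omega
    rw [ZMod.χ₄_nat_one_mod_four h1, ZMod.χ₄_nat_three_mod_four hm3]
    norm_num
  · have hm1 : (2 ^ (s - l) - μ) % 4 = 1 := by omega
    rw [ZMod.χ₄_nat_three_mod_four h3, ZMod.χ₄_nat_one_mod_four hm1]
    norm_num

/-- Paper Lemma 2.1 (lem:f0): `h_{f₀}(2^s) = −2^s + 3` for `s ≥ 2`. [folklore] -/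
theorem hCK_f0_two_pow {s : ℕ} (hs : 2 ≤ s) : hCK f0 (2 ^ s) = -(2 ^ s : ℤ) + 3 := by
  have hpow : (2 : ℕ) ^ s = 2 ^ (s - 1) * 2 := by
    rw [← pow_succ]
    congr 1
    omega
  have hhalf1 : 0 < (2 : ℕ) ^ (s - 1) := pow_pos (by norm_num) (s - 1)
  have hmem : 2 ^ (s - 1) ∈ Finset.Ico 1 (2 ^ s) := by
    rw [Finset.mem_Ico]
    omega
  rw [hCK, ← Finset.sum_erase_add _ _ hmem]
  have hterm : f0 (2 ^ (s - 1)) * f0 (2 ^ s - 2 ^ (s - 1)) = 1 := by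
    have hmid : (2 : ℕ) ^ s - 2 ^ (s - 1) = 2 ^ (s - 1) := by omega
    have hval : f0 (2 ^ (s - 1)) = 1 := by
      have h1 : (2 : ℕ) ^ (s - 1) = 2 ^ (s - 1) * 1 := (mul_one _).symm
      rw [h1, f0_two_pow_mul (by norm_num)]
      exact ZMod.χ₄_nat_one_mod_four (by norm_num)
    rw [hmid, hval, mul_one]
  have hrest : ∀ ν ∈ (Finset.Ico 1 (2 ^ s)).erase (2 ^ (s - 1)),
      f0 ν * f0 (2 ^ s - ν) = -1 := by
    intro ν hν
    obtain ⟨hne, hIco⟩ := Finset.mem_erase.mp hν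
    rw [Finset.mem_Ico] at hIco
    exact f0_mul_f0_eq_neg_one hs hIco.1 hIco.2 hne
  rw [Finset.sum_congr rfl hrest, Finset.sum_const, hterm,
    Finset.card_erase_of_mem hmem, Nat.card_Ico, nsmul_eq_mul]
  have hpow2 : (2 : ℕ) ^ (s - 1) = 2 ^ (s - 2) * 2 := by
    rw [← pow_succ]
    congr 1
    omega
  have hhalf2 : 0 < (2 : ℕ) ^ (s - 2) := pow_pos (by norm_num) (s - 2)
  have h4 : (4 : ℕ) ≤ 2 ^ s := by omega
  rw [Nat.cast_sub (by omega), Nat.cast_sub (by omega)]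
  push_cast
  ring

/-! ### The thin-flip comparison (proof of Theorem 1.1, third part) -/

/-- The "bad" indices `ν ∈ [1, N−1]` at which the flip can act: some `p ∈ R`
divides `ν (N − ν)`. [folklore] -/
def badSet (R : Set ℕ) (N : ℕ) : Finset ℕ :=
  (Finset.Ico 1 N).filter fun ν => ∃ p ∈ R, p ∣ ν ∨ p ∣ (N - ν)

/-- Off the bad set the summands of `h_{fCE}` and `h_{f₀}` agree. [folklore] -/
theorem hCK_fCE_sub_le (R : Set ℕ) (N : ℕ) :
    hCK (fCE R) N ≤ hCK f0 N + 2 * ((badSet R N).card : ℤ) := by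
  have hBsub : badSet R N ⊆ Finset.Ico 1 N := Finset.filter_subset _ _
  have hdiff : hCK (fCE R) N - hCK f0 N
      = ∑ ν ∈ badSet R N, (fCE R ν * fCE R (N - ν) - f0 ν * f0 (N - ν)) := by
    rw [hCK, hCK, ← Finset.sum_sub_distrib]
    symm
    apply Finset.sum_subset hBsub
    intro ν hIco hνB
    have hno : ∀ p ∈ R, ¬ (p ∣ ν ∨ p ∣ (N - ν)) := by
      intro p hp hcon
      exact hνB (Finset.mem_filter.mpr ⟨hIco, ⟨p, hp, hcon⟩⟩)
    have h1 : fCE R ν = f0 ν :=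
      fCE_eq_f0_of_no_factor_in R fun p hp hd => hno p hp (Or.inl hd)
    have h2 : fCE R (N - ν) = f0 (N - ν) :=
      fCE_eq_f0_of_no_factor_in R fun p hp hd => hno p hp (Or.inr hd)
    rw [h1, h2, sub_self]
  have hpt : ∀ ν ∈ badSet R N,
      fCE R ν * fCE R (N - ν) - f0 ν * f0 (N - ν) ≤ 2 := by
    intro ν hν
    have hIco := Finset.mem_Ico.mp (hBsub hν)
    have h1 : 1 ≤ ν := hIco.1
    have h2 : 1 ≤ N - ν := by omega
    rcases fCE_pm R h1 with ha | ha <;> rcases fCE_pm R h2 with hb | hb <;>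
      rcases f0_pm h1 with hc | hc <;> rcases f0_pm h2 with hd | hd <;>
      rw [ha, hb, hc, hd] <;> norm_num
  have hsum : ∑ ν ∈ badSet R N, (fCE R ν * fCE R (N - ν) - f0 ν * f0 (N - ν))
      ≤ ∑ _ν ∈ badSet R N, (2 : ℤ) := Finset.sum_le_sum hpt
  rw [Finset.sum_const, nsmul_eq_mul] at hsum
  omega

/-- Counting: `#(badSet R N) ≤ ∑_{p ∈ R, p < N} 2 ⌊(N−1)/p⌋ ≤ (N−1)/4` when every
finite reciprocal subsum of `R` is `≤ 1/8`. [folklore] -/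
theorem card_badSet_le {R : Set ℕ}
    (hR8 : ∀ F : Finset ℕ, (∀ p ∈ F, p ∈ R) → ∑ p ∈ F, (1 : ℝ) / p ≤ 1 / 8)
    (N : ℕ) : ((badSet R N).card : ℝ) ≤ ((N - 1 : ℕ) : ℝ) / 4 := by
  set RN := (Finset.range N).filter (· ∈ R) with hRN
  -- cover the bad set by the divisibility fibres of the (finitely many) relevant p ∈ R
  have hsub : badSet R N
      ⊆ RN.biUnion fun p => (Finset.Ico 1 N).filter fun ν => p ∣ ν ∨ p ∣ (N - ν) := by
    intro ν hν
    obtain ⟨hIco, p, hpR, hpdvd⟩ := Finset.mem_filter.mp hν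
    rw [Finset.mem_Ico] at hIco
    have hplt : p < N := by
      rcases hpdvd with h | h
      · have : p ≤ ν := Nat.le_of_dvd (by omega) h
        omega
      · have : p ≤ N - ν := Nat.le_of_dvd (by omega) h
        omega
    exact Finset.mem_biUnion.mpr ⟨p, Finset.mem_filter.mpr ⟨Finset.mem_range.mpr hplt, hpR⟩,
      Finset.mem_filter.mpr ⟨Finset.mem_Ico.mpr hIco, hpdvd⟩⟩
  have hcard1 : (badSet R N).card
      ≤ ∑ p ∈ RN, ((Finset.Ico 1 N).filter fun ν => p ∣ ν ∨ p ∣ (N - ν)).card :=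
    le_trans (Finset.card_le_card hsub) Finset.card_biUnion_le
  -- each fibre has at most 2⌊(N−1)/p⌋ elements
  have hper : ∀ p ∈ RN,
      ((Finset.Ico 1 N).filter fun ν => p ∣ ν ∨ p ∣ (N - ν)).card ≤ 2 * ((N - 1) / p) := by
    intro p _hp
    have hIcoIoc : Finset.Ico 1 N = Finset.Ioc 0 (N - 1) := by
      ext x
      rw [Finset.mem_Ico, Finset.mem_Ioc]
      omega
    have hcount1 : ((Finset.Ico 1 N).filter fun ν => p ∣ ν).card = (N - 1) / p := by
      rw [hIcoIoc]
      exact Nat.Ioc_filter_dvd_card_eq_div (N - 1) p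
    have hcount2 : ((Finset.Ico 1 N).filter fun ν => p ∣ (N - ν)).card
        = ((Finset.Ico 1 N).filter fun ν => p ∣ ν).card := by
      apply Finset.card_nbij' (fun ν => N - ν) (fun ν => N - ν)
      · intro ν hν
        simp only [Finset.coe_filter, Set.mem_setOf_eq, Finset.mem_Ico] at hν ⊢
        omega
      · intro ν hν
        simp only [Finset.coe_filter, Set.mem_setOf_eq, Finset.mem_Ico] at hν ⊢
        constructor
        · omega
        · have : N - (N - ν) = ν := by omega
          rw [this]
          exact hν.2
      · intro ν hν
        simp only [Finset.coe_filter, Set.mem_setOf_eq, Finset.mem_Ico] at hν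
        show N - (N - ν) = ν
        omega
      · intro ν hν
        simp only [Finset.coe_filter, Set.mem_setOf_eq, Finset.mem_Ico] at hν
        show N - (N - ν) = ν
        omega
    have hunion : ((Finset.Ico 1 N).filter fun ν => p ∣ ν ∨ p ∣ (N - ν))
        ⊆ ((Finset.Ico 1 N).filter fun ν => p ∣ ν)
          ∪ ((Finset.Ico 1 N).filter fun ν => p ∣ (N - ν)) := by
      intro ν hν
      obtain ⟨h1, h2⟩ := Finset.mem_filter.mp hν
      rcases h2 with h | h
      · exact Finset.mem_union_left _ (Finset.mem_filter.mpr ⟨h1, h⟩)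
      · exact Finset.mem_union_right _ (Finset.mem_filter.mpr ⟨h1, h⟩)
    calc ((Finset.Ico 1 N).filter fun ν => p ∣ ν ∨ p ∣ (N - ν)).card
        ≤ (((Finset.Ico 1 N).filter fun ν => p ∣ ν)
            ∪ ((Finset.Ico 1 N).filter fun ν => p ∣ (N - ν))).card :=
          Finset.card_le_card hunion
      _ ≤ ((Finset.Ico 1 N).filter fun ν => p ∣ ν).card
            + ((Finset.Ico 1 N).filter fun ν => p ∣ (N - ν)).card :=
          Finset.card_union_le _ _
      _ = 2 * ((N - 1) / p) := by rw [hcount1, hcount2, hcount1]; ring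
  have hcard2 : (badSet R N).card ≤ ∑ p ∈ RN, 2 * ((N - 1) / p) :=
    le_trans hcard1 (Finset.sum_le_sum hper)
  -- pass to ℝ and use the reciprocal-subsum hypothesis
  have hcast : ((badSet R N).card : ℝ) ≤ ∑ p ∈ RN, 2 * (((N - 1 : ℕ) : ℝ) / p) := by
    calc ((badSet R N).card : ℝ) ≤ ((∑ p ∈ RN, 2 * ((N - 1) / p) : ℕ) : ℝ) := by
          exact_mod_cast hcard2
      _ = ∑ p ∈ RN, ((2 * ((N - 1) / p) : ℕ) : ℝ) := by push_cast; rfl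
      _ ≤ ∑ p ∈ RN, 2 * (((N - 1 : ℕ) : ℝ) / p) := by
          refine Finset.sum_le_sum fun p _ => ?_
          have hd : (((N - 1) / p : ℕ) : ℝ) ≤ ((N - 1 : ℕ) : ℝ) / (p : ℝ) := Nat.cast_div_le
          push_cast
          linarith
  have hRsum : ∑ p ∈ RN, (1 : ℝ) / p ≤ 1 / 8 :=
    hR8 RN fun p hp => (Finset.mem_filter.mp hp).2
  have hfactor : ∑ p ∈ RN, 2 * (((N - 1 : ℕ) : ℝ) / p)
      = 2 * ((N - 1 : ℕ) : ℝ) * ∑ p ∈ RN, (1 : ℝ) / p := by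
    rw [Finset.mul_sum]
    refine Finset.sum_congr rfl fun p _ => ?_
    ring
  have hNN : (0 : ℝ) ≤ ((N - 1 : ℕ) : ℝ) := Nat.cast_nonneg _
  calc ((badSet R N).card : ℝ) ≤ 2 * ((N - 1 : ℕ) : ℝ) * ∑ p ∈ RN, (1 : ℝ) / p := by
        rw [← hfactor]; exact hcast
    _ ≤ 2 * ((N - 1 : ℕ) : ℝ) * (1 / 8) := by
        apply mul_le_mul_of_nonneg_left hRsum
        positivity
    _ = ((N - 1 : ℕ) : ℝ) / 4 := by ring

/-- Theorem 1.1, third clause: `h_f(2^s) ≤ −2^{s−1} + 3` for all `s ≥ 2`. [folklore] -/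
theorem hCK_fCE_two_pow_le {R : Set ℕ}
    (hR8 : ∀ F : Finset ℕ, (∀ p ∈ F, p ∈ R) → ∑ p ∈ F, (1 : ℝ) / p ≤ 1 / 8)
    {s : ℕ} (hs : 2 ≤ s) : hCK (fCE R) (2 ^ s) ≤ -(2 ^ (s - 1) : ℤ) + 3 := by
  have hpow : (2 : ℕ) ^ s = 2 ^ (s - 1) * 2 := by
    rw [← pow_succ]
    congr 1
    omega
  have hhalf1 : 0 < (2 : ℕ) ^ (s - 1) := pow_pos (by norm_num) (s - 1)
  -- the bad count is ≤ 2^{s−1}/2 in ℝ, so 2·#bad ≤ 2^{s−1} in ℕ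
  have hb2 : 2 * (badSet R (2 ^ s)).card ≤ 2 ^ (s - 1) := by
    have h1 : ((badSet R (2 ^ s)).card : ℝ) ≤ ((2 ^ s - 1 : ℕ) : ℝ) / 4 :=
      card_badSet_le hR8 (2 ^ s)
    have h2 : ((2 ^ s - 1 : ℕ) : ℝ) ≤ ((2 ^ s : ℕ) : ℝ) := by
      exact_mod_cast Nat.sub_le _ _
    have h3 : (4 * (badSet R (2 ^ s)).card : ℝ) ≤ ((2 ^ s : ℕ) : ℝ) := by
      push_cast at h1 h2 ⊢
      linarith
    have h4 : 4 * (badSet R (2 ^ s)).card ≤ 2 ^ s := by exact_mod_cast h3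
    omega
  have hle := hCK_fCE_sub_le R (2 ^ s)
  rw [hCK_f0_two_pow hs] at hle
  have hbZ : 2 * ((badSet R (2 ^ s)).card : ℤ) ≤ (2 ^ (s - 1) : ℕ) := by exact_mod_cast hb2
  have hpowZ : ((2 : ℕ) ^ s : ℤ) = ((2 : ℕ) ^ (s - 1) : ℤ) * 2 := by exact_mod_cast hpow
  push_cast at hbZ hpowZ hle ⊢
  linarith

end

end Literature.NumberTheory.Multiplicative.CorradiKatai1969
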